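import Summits.RiemannHypothesis.RiemannHypothesis.Theorems.JensenLogBandArcModelCompareFactors
import Summits.RiemannHypothesis.RiemannHypothesis.Theorems.JensenLogBandArcSaddleDisplacement
import Summits.RiemannHypothesis.RiemannHypothesis.Theorems.JensenLogBandZetaWindow
import HarnessLib

/-!
# Main term versus translated-saddle model, II: [CMP] in product form (near zone of the BAND crux)

RH ladder column JENSEN, rung J-P(P3) «log band», BAND crux `XiDerivBandRealAllRates`
(stmt-RiemannHypothesis-19913) of route «JensenLogBand», line «band-one-window» (top-shell reshape,
BAND lead rh-jensen-prover g8; the lead's ASK [CMP] of STATUS 2026-08-27T05:38:24Z, plan of eng-2 g6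
05:50:34Z). RH-FREE calculus of two explicit model functions. WHAT THIS IS NOT: nothing here bears on
zeros of `ζ` off the line or the truth of RH.

Two centres `c₀ = x₀ + iT₀`, `c = x + iT` in regime R2 (`h₀, h ≤ 20`) with `‖c − c₀‖ ≤ R ≤ 1/20`,
`|h − h₀| ≤ h/20`, saddles `u₀` (`S_{n,c₀}(u₀) = 0`) and `u*` (`S_{n,c}(u*) = 0`) in their S3 discs, and
the base window right of the `1`-line: `1 + δ + 2R ≤ Re(½ + u₀)`. With the rigid translate
`ũ = u₀ − c₀ + c` (`‖u* − ũ‖ ≤ d := 110·n·R/(T₀ ℓ_T ℓ_{T₀})`, [DISP]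
`LogBandArc.norm_arcSaddle_sub_translate_le`) the ratio `Main(c, u*)/M̃(c)` is the product of

* the DENSITY factor `exp(E)`, `‖E‖ ≤ M_S d²` (`LogBandArc.arcDensity_saddle_eq_mul_exp`);
* the `ζ` factor `ζ(½+u*)/ζ(½+ũ)`, within `(d/δ)e^{d/δ}` of `1`
  (`LogBandArc.norm_riemannZeta_div_sub_one_le_of_norm_le`);
* the CURVATURE factor `(π/w)^{1/2}/(π/w₀)^{1/2}`, within `√2·‖w − w₀‖/‖w‖` of `1`, where both
  curvatures are within `7.7h²/T` of `n/2` (`norm_arcCurv_sub_half_le`) and `Re w ≥ 11n/40`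
  (`LogBandArc.descentDensity_saddle`).

Main result: **`norm_arcMainTerm_sub_arcShiftModel_le`** —
`‖Main(c,u*) − M̃_{c₀,u₀}(c)‖ ≤ ((1 + ε₁e^{ε₁})(1 + ε₂e^{ε₂})(1 + ε₃) − 1)·‖M̃_{c₀,u₀}(c)‖` with explicit
`ε₁ = M_S d²`, `ε₂ = d/δ`, `ε₃ = √2·7.7(h²/T + h₀²/T₀)/((11/40)n)`. The numeric form (`ε = 1/100` under
`10⁴·n² ≤ δ·T₀`) is in `JensenLogBandArcModelCompareNumeric.lean`. (prover-rh-jensen-eng-2-g7-0, 2026-08-27.)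
-/

noncomputable section

-- single-problem summit: `Summit.RiemannHypothesis.RiemannHypothesis.…` is the tree convention
set_option linter.dupNamespace false

open Complex Real Set Metric
open scoped Interval

namespace Summit.RiemannHypothesis.RiemannHypothesis.Theorems.JensenPolynomials.LogBandArc

open Literature.NumberTheory.LFunctions

/-! ## The curvature factor: both curvatures are within `7.7 h²/T` of `n/2` -/

section curvature

variable {n : ℕ} {x T : ℝ} {u : ℂ}

/-- In regime R2: `33/(4T) + 1/(0.79T)² + (n+1)/(1.79T)² ≤ 8.31/T` (`T ≥ 1200`, `n + 1 ≤ T/6`).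
[folklore] -/
theorem saddleDenDeriv_bound_le (hT : 100 ≤ T) (hℓ : 20 ≤ ell T) (hh : 1 / 2 ≤ bandRadius n T)
    (hH : bandRadius n T ≤ 20) :
    33 / 4 / T + 1 / (79 / 100 * T) ^ 2 + ((n : ℝ) + 1) / (179 / 100 * T) ^ 2 ≤ 831 / 100 / T := by
  obtain ⟨-, -, -, hT1200, hnT⟩ := R2_bookkeeping hT hℓ hh hH
  have hT0 : 0 < T := by linarith
  have h1 : 1 / (79 / 100 * T) ^ 2 ≤ 1 / 700 / T := by
    rw [div_div]
    exact one_div_le_one_div_of_le (by positivity) (by nlinarith)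
  have h2 : ((n : ℝ) + 1) / (179 / 100 * T) ^ 2 ≤ 1 / 19 / T := by
    rw [div_div, div_le_div_iff₀ (by positivity) (by positivity)]
    nlinarith
  have e : 33 / 4 / T + 1 / 700 / T + 1 / 19 / T ≤ 831 / 100 / T := by
    rw [← add_div, ← add_div]
    exact div_le_div_of_nonneg_right (by norm_num) hT0.le
  linarith

/-- **The window curvature is close to `n/2`:** for the saddle `u*` of `S_{n,c}` (regime R2),
`‖w − n/2‖ ≤ (33/(4T) + 1/(0.79T)² + (n+1)/(1.79T)²)·‖u* − c‖²/2 ≤ 7.7·h²/T`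
(`w = S′(u*)(u*−c)²/2 = n/2 + D′(u*)(u*−c)²/2`, `‖u* − c‖ ≤ h + ε ≤ (34/25)h`). [folklore] -/
theorem norm_arcCurv_sub_half_le (hx : |x| ≤ 1 / 2) (hT : 100 ≤ T) (hℓ : 20 ≤ ell T)
    (hn : 100 ≤ n) (hh : 1 / 2 ≤ bandRadius n T) (hhT : bandRadius n T ≤ 7 / 20 * T)
    (hH : bandRadius n T ≤ 20)
    (hu : ‖u - ((x : ℂ) + (T : ℂ) * I + bandRadius n T)‖ ≤ 3 / 5 * bandRadius n T)
    (hS : arcSaddleFn n ((x : ℂ) + (T : ℂ) * I) u = 0) :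
    ‖arcCurv n ((x : ℂ) + (T : ℂ) * I) u - (n : ℂ) / 2‖ ≤ 77 / 10 * bandRadius n T ^ 2 / T := by
  obtain ⟨-, hεh, -, hT1200, -⟩ := R2_bookkeeping hT hℓ hh hH
  obtain ⟨-, -, -, hr_hi⟩ := arcSaddle_sharp_polar hx hT hℓ hn hh hhT hH hu hS
  obtain ⟨D', hD', hb⟩ := hasDerivAt_arcSaddleFn hx hT hℓ hn hh hhT hu
  obtain ⟨-, -, -, huc, -, -⟩ := disc_good_point hx hT hh hhT hu
  have hBD := saddleDenDeriv_bound_le hT hℓ hh hH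
  have hT0 : 0 < T := by linarith
  set h : ℝ := bandRadius n T with hhdef
  have hh0 : 0 < h := by linarith
  generalize hc : ((x : ℂ) + (T : ℂ) * I) = c at *
  have huc' : u - c ≠ 0 := sub_ne_zero.2 huc
  rw [arcCurv, hD'.deriv]
  have e : (D' + (n : ℂ) / (u - c) ^ 2) * (u - c) ^ 2 / 2 - (n : ℂ) / 2 = D' * (u - c) ^ 2 / 2 := by
    field_simp
    ring
  rw [e, norm_div, Complex.norm_two, norm_mul, norm_pow]
  have hr : ‖u - c‖ ≤ 34 / 25 * h := by linarith
  have hr2 : ‖u - c‖ ^ 2 ≤ (34 / 25 * h) ^ 2 := pow_le_pow_left₀ (norm_nonneg _) hr 2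
  have hD'' : ‖D'‖ ≤ 831 / 100 / T := hb.trans hBD
  calc ‖D'‖ * ‖u - c‖ ^ 2 / 2 ≤ (831 / 100 / T) * (34 / 25 * h) ^ 2 / 2 := by
        gcongr
    _ ≤ 77 / 10 * h ^ 2 / T := by
        rw [div_mul_eq_mul_div, div_div, div_le_div_iff₀ (by positivity) hT0]
        nlinarith [sq_nonneg h]

/-- **The curvature has positive real part** `Re w ≥ (11/40)n` and `‖w‖ ≤ (29/40)n` (restatement of
`descentDensity_saddle` for `LogBandArc.arcCurv`). [folklore] -/
theorem arcCurv_re_norm (hx : |x| ≤ 1 / 2) (hT : 100 ≤ T) (hℓ : 20 ≤ ell T)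
    (hn : 100 ≤ n) (hh : 1 / 2 ≤ bandRadius n T) (hhT : bandRadius n T ≤ 7 / 20 * T)
    (hu : ‖u - ((x : ℂ) + (T : ℂ) * I + bandRadius n T)‖ ≤ 3 / 5 * bandRadius n T)
    (hS : arcSaddleFn n ((x : ℂ) + (T : ℂ) * I) u = 0) :
    (11 / 40 : ℝ) * n ≤ (arcCurv n ((x : ℂ) + (T : ℂ) * I) u).re ∧
      ‖arcCurv n ((x : ℂ) + (T : ℂ) * I) u‖ ≤ 29 / 40 * n := by
  obtain ⟨-, hre, hnorm⟩ := descentDensity_saddle hx hT hℓ hn hh hhT hu hS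
  exact ⟨hre, hnorm⟩

end curvature

/-! ## [CMP] — the main term against the translated-saddle model -/

section compare

variable {n : ℕ} {x₀ T₀ x T R : ℝ} {u₀ u : ℂ}

set_option maxHeartbeats 800000 in -- long chain of explicit norm estimates in a large context, no search
/-- **[CMP] (product form).** Two centres `c₀ = x₀ + iT₀`, `c = x + iT` in regime R2 (`h₀, h ≤ 20`) with
`‖c − c₀‖ ≤ R ≤ 1/20`, `|h − h₀| ≤ h/20`; saddles `u₀`, `u*` in their S3 discs; base window
`1 + δ + 2R ≤ Re(½ + u₀)`. Then, with `d = 110·n·R/(T₀ ℓ_T ℓ_{T₀})`,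
`ε₁ = (33/(4T) + 1/(0.79T)² + (n+1)/(1.79T)² + 25n/(4h²))·d²`, `ε₂ = d/δ`,
`ε₃ = √2·(7.7(h²/T + h₀²/T₀))/((11/40)n)`:
`‖Main(c,u*) − M̃_{c₀,u₀}(c)‖ ≤ ((1 + ε₁e^{ε₁})(1 + ε₂e^{ε₂})(1 + ε₃) − 1)·‖M̃_{c₀,u₀}(c)‖`.
RH-FREE. [folklore] -/
theorem norm_arcMainTerm_sub_arcShiftModel_le (hx₀ : |x₀| ≤ 1 / 2) (hT₀ : 100 ≤ T₀)
    (hℓ₀ : 20 ≤ ell T₀) (hn : 100 ≤ n) (hh₀ : 1 / 2 ≤ bandRadius n T₀)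
    (hh₀T : bandRadius n T₀ ≤ 7 / 20 * T₀) (hH₀ : bandRadius n T₀ ≤ 20)
    (hu₀ : ‖u₀ - ((x₀ : ℂ) + (T₀ : ℂ) * I + bandRadius n T₀)‖ ≤ 3 / 5 * bandRadius n T₀)
    (hS₀ : arcSaddleFn n ((x₀ : ℂ) + (T₀ : ℂ) * I) u₀ = 0)
    (hx : |x| ≤ 1 / 2) (hT : 100 ≤ T) (hℓ : 20 ≤ ell T) (hh : 1 / 2 ≤ bandRadius n T)
    (hhT : bandRadius n T ≤ 7 / 20 * T) (hH : bandRadius n T ≤ 20)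
    (hu : ‖u - ((x : ℂ) + (T : ℂ) * I + bandRadius n T)‖ ≤ 3 / 5 * bandRadius n T)
    (hS : arcSaddleFn n ((x : ℂ) + (T : ℂ) * I) u = 0)
    (hR : R ≤ 1 / 20) (hcc : ‖((x : ℂ) + (T : ℂ) * I) - ((x₀ : ℂ) + (T₀ : ℂ) * I)‖ ≤ R)
    (hhh : |bandRadius n T - bandRadius n T₀| ≤ bandRadius n T / 20)
    {δ : ℝ} (hδ : 0 < δ) (hδσ : 1 + δ + 2 * R ≤ (1 / 2 + u₀).re) :
    ‖arcMainTerm n ((x : ℂ) + (T : ℂ) * I) u -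
        arcShiftModel n ((x₀ : ℂ) + (T₀ : ℂ) * I) u₀ ((x : ℂ) + (T : ℂ) * I)‖ ≤
      ((1 + ((33 / 4 / T + 1 / (79 / 100 * T) ^ 2 + ((n : ℝ) + 1) / (179 / 100 * T) ^ 2 +
            25 * n / (4 * bandRadius n T ^ 2)) * (110 * n * R / (T₀ * ell T * ell T₀)) ^ 2) *
          Real.exp ((33 / 4 / T + 1 / (79 / 100 * T) ^ 2 + ((n : ℝ) + 1) / (179 / 100 * T) ^ 2 +
            25 * n / (4 * bandRadius n T ^ 2)) * (110 * n * R / (T₀ * ell T * ell T₀)) ^ 2)) *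
        (1 + (110 * n * R / (T₀ * ell T * ell T₀)) / δ *
          Real.exp ((110 * n * R / (T₀ * ell T * ell T₀)) / δ)) *
        (1 + Real.sqrt 2 * (77 / 10 * (bandRadius n T ^ 2 / T + bandRadius n T₀ ^ 2 / T₀)) /
          (11 / 40 * n)) - 1) *
      ‖arcShiftModel n ((x₀ : ℂ) + (T₀ : ℂ) * I) u₀ ((x : ℂ) + (T : ℂ) * I)‖ := by
  -- bookkeeping
  obtain ⟨-, hεh₀, -, hT1200₀, hnT₀⟩ := R2_bookkeeping hT₀ hℓ₀ hh₀ hH₀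
  obtain ⟨-, hεh, -, hT1200, hnT⟩ := R2_bookkeeping hT hℓ hh hH
  have hT0 : 0 < T := by linarith
  have hT00 : 0 < T₀ := by linarith
  have hℓpos : 0 < ell T := by linarith
  have hℓ0pos : 0 < ell T₀ := by linarith
  have hR0 : 0 ≤ R := (norm_nonneg _).trans hcc
  have hnpos : (0 : ℝ) < n := by exact_mod_cast (show 0 < n by omega)
  have hh0 : 0 < bandRadius n T := by linarith
  have hh00 : 0 < bandRadius n T₀ := by linarith
  -- [DISP]
  have hdisp := norm_arcSaddle_sub_translate_le hx₀ hT₀ hℓ₀ hn hh₀ hh₀T hH₀ hu₀ hS₀ hx hT hℓ hh hhT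
    hu hS hR hcc hhh
  set d : ℝ := 110 * n * R / (T₀ * ell T * ell T₀) with hddef
  have hd0 : 0 ≤ d := by positivity
  have hdR : d ≤ R / 20 := by
    rw [hddef, div_le_div_iff₀ (by positivity) (by norm_num)]
    have hn6 : (n : ℝ) ≤ T₀ / 6 := by linarith
    have hℓℓ : (400 : ℝ) ≤ ell T * ell T₀ := by nlinarith
    have h4 : R * (T₀ * 400) ≤ R * (T₀ * (ell T * ell T₀)) :=
      mul_le_mul_of_nonneg_left (mul_le_mul_of_nonneg_left hℓℓ hT00.le) hR0
    have h5 : 110 * (n : ℝ) * R * 20 ≤ 110 * (T₀ / 6) * R * 20 := by gcongr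
    have e : 110 * (T₀ / 6) * R * 20 ≤ R * (T₀ * 400) := by nlinarith
    linarith
  have hdh : d ≤ bandRadius n T / 5 := by linarith
  have hdist : ‖u - (u₀ - ((x₀ : ℂ) + (T₀ : ℂ) * I) + ((x : ℂ) + (T : ℂ) * I))‖ ≤ d := hdisp
  -- (i) the density factor
  obtain ⟨E, hPE, hEn⟩ := arcDensity_saddle_eq_mul_exp hx hT hℓ hn hh hhT hH hu hS hdist hdh
  -- the translate lies in the disc about `c + h`; good-point facts there and at `u*`
  have hε := norm_arcSaddle_sub_center_sub_radius_le hx hT hℓ hn hh hhT hH hu hS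
  have hut_disc : ‖(u₀ - ((x₀ : ℂ) + (T₀ : ℂ) * I) + ((x : ℂ) + (T : ℂ) * I)) -
      ((x : ℂ) + (T : ℂ) * I + bandRadius n T)‖ ≤ 3 / 5 * bandRadius n T := by
    have e : (u₀ - ((x₀ : ℂ) + (T₀ : ℂ) * I) + ((x : ℂ) + (T : ℂ) * I)) -
        ((x : ℂ) + (T : ℂ) * I + bandRadius n T) =
        (u - ((x : ℂ) + (T : ℂ) * I + bandRadius n T)) -
          (u - (u₀ - ((x₀ : ℂ) + (T₀ : ℂ) * I) + ((x : ℂ) + (T : ℂ) * I))) := by ring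
    rw [e]
    refine (norm_sub_le _ _).trans ?_
    linarith
  obtain ⟨hre_t, h1_t, h0_t, hc_t, hpc_t, -⟩ := disc_good_point hx hT hh hhT hut_disc
  -- (iii) curvature facts at both centres
  have hw := norm_arcCurv_sub_half_le hx hT hℓ hn hh hhT hH hu hS
  have hw₀ := norm_arcCurv_sub_half_le hx₀ hT₀ hℓ₀ hn hh₀ hh₀T hH₀ hu₀ hS₀
  obtain ⟨hwre, -⟩ := arcCurv_re_norm hx hT hℓ hn hh hhT hu hS
  obtain ⟨hw₀re, -⟩ := arcCurv_re_norm hx₀ hT₀ hℓ₀ hn hh₀ hh₀T hu₀ hS₀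
  -- names
  generalize hc₀ : ((x₀ : ℂ) + (T₀ : ℂ) * I) = c₀ at *
  generalize hc : ((x : ℂ) + (T : ℂ) * I) = c at *
  have hc₀re : c₀.re = x₀ := by rw [← hc₀]; simp
  have hcre : c.re = x := by rw [← hc]; simp
  set ut : ℂ := u₀ - c₀ + c with hut
  set w : ℂ := arcCurv n c u with hwdef
  set w₀ : ℂ := arcCurv n c₀ u₀ with hw₀def
  set s₀ : ℂ := 1 / 2 + ut with hs₀
  set s : ℂ := 1 / 2 + u with hs
  set M : ℝ := 33 / 4 / T + 1 / (79 / 100 * T) ^ 2 + ((n : ℝ) + 1) / (179 / 100 * T) ^ 2 +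
    25 * n / (4 * bandRadius n T ^ 2) with hM
  -- (ii) the `ζ` factor
  have hccre : |x - x₀| ≤ R := by
    have := (Complex.abs_re_le_norm (c - c₀)).trans hcc
    rw [Complex.sub_re, hcre, hc₀re] at this; exact this
  have hccre' := abs_le.1 hccre
  have hs₀re' : 1 + δ + R ≤ s₀.re := by
    have e : s₀.re = (1 / 2 + u₀).re + (x - x₀) := by
      rw [hs₀, hut]; simp [hcre, hc₀re]; ring
    rw [e]; linarith
  have hs₀re : 1 + δ ≤ s₀.re := by linarith
  have hsd : ‖s - s₀‖ ≤ d := by rw [show s - s₀ = u - ut by rw [hs, hs₀]; ring]; exact hdist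
  have hsre : 1 + δ ≤ s.re := by
    have h1 : |(s - s₀).re| ≤ d := (Complex.abs_re_le_norm (s - s₀)).trans hsd
    rw [Complex.sub_re] at h1
    have h1' := abs_le.1 h1
    linarith
  have hζ := norm_riemannZeta_div_sub_one_le_of_norm_le hδ hs₀re hsre hsd
  have hζ₀ : riemannZeta s₀ ≠ 0 := riemannZeta_ne_zero_of_one_lt_re (by linarith)
  -- (iii) the curvature factor
  have hwre0 : 0 < w.re := lt_of_lt_of_le (by positivity) hwre
  have hw₀re0 : 0 < w₀.re := lt_of_lt_of_le (by positivity) hw₀re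
  have hw0 : w ≠ 0 := fun h => by rw [h] at hwre0; simp at hwre0
  have hw₀0 : w₀ ≠ 0 := fun h => by rw [h] at hw₀re0; simp at hw₀re0
  have hQ := norm_sqrt_pi_div_sub_le hwre0 hw₀re0
  set Q : ℂ := ((π : ℂ) / w) ^ (1 / 2 : ℂ) with hQdef
  set Q₀ : ℂ := ((π : ℂ) / w₀) ^ (1 / 2 : ℂ) with hQ₀def
  have hQ₀0 : Q₀ ≠ 0 := by
    rw [hQ₀def, Ne, Complex.cpow_eq_zero_iff, not_and_or]
    left
    exact div_ne_zero (by exact_mod_cast Real.pi_ne_zero) hw₀0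
  have hnQ₀ : 0 < ‖Q₀‖ := norm_pos_iff.2 hQ₀0
  have hww₀ : ‖w - w₀‖ ≤ 77 / 10 * (bandRadius n T ^ 2 / T + bandRadius n T₀ ^ 2 / T₀) := by
    have e : w - w₀ = (w - (n : ℂ) / 2) - (w₀ - (n : ℂ) / 2) := by ring
    rw [e]
    refine (norm_sub_le _ _).trans ?_
    have e2 : 77 / 10 * (bandRadius n T ^ 2 / T + bandRadius n T₀ ^ 2 / T₀) =
        77 / 10 * bandRadius n T ^ 2 / T + 77 / 10 * bandRadius n T₀ ^ 2 / T₀ := by ring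
    rw [e2]; exact add_le_add hw hw₀
  have hwn : 11 / 40 * (n : ℝ) ≤ ‖w‖ := hwre.trans (Complex.re_le_norm w)
  have hratio : ‖w - w₀‖ / ‖w‖ ≤
      77 / 10 * (bandRadius n T ^ 2 / T + bandRadius n T₀ ^ 2 / T₀) / (11 / 40 * n) :=
    div_le_div₀ (by positivity) hww₀ (by positivity) hwn
  have hQrel : ‖Q / Q₀ - 1‖ ≤ Real.sqrt 2 *
      (77 / 10 * (bandRadius n T ^ 2 / T + bandRadius n T₀ ^ 2 / T₀)) / (11 / 40 * n) := by
    have e : Q / Q₀ - 1 = (Q - Q₀) / Q₀ := by field_simp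
    rw [e, norm_div, div_le_iff₀ hnQ₀]
    refine hQ.trans ?_
    rw [mul_div_assoc]
    gcongr
  -- (i) the density factor, as a bound on `‖e^E − 1‖`
  have hM0 : 0 ≤ M := by positivity
  have hEexp : ‖Complex.exp E - 1‖ ≤ M * d ^ 2 * Real.exp (M * d ^ 2) := by
    refine (norm_cexp_sub_one_le_mul_exp E).trans ?_
    exact mul_le_mul hEn (Real.exp_le_exp.2 hEn) (Real.exp_pos _).le (by positivity)
  -- the algebra: `Main − M̃ = M̃ · (e^E · ζ-ratio · Q/Q₀ − 1)`
  have hmodel : arcMainTerm n c u - arcShiftModel n c₀ u₀ c =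
      arcShiftModel n c₀ u₀ c *
        (Complex.exp E * (riemannZeta s / riemannZeta s₀) * (Q / Q₀) - 1) := by
    rw [arcMainTerm, arcShiftModel, hPE]
    simp only [← hs, ← hs₀, ← hut]
    field_simp
    ring
  rw [hmodel, norm_mul, mul_comm]
  refine mul_le_mul_of_nonneg_right ?_ (norm_nonneg _)
  exact norm_mul_mul_sub_one_le hEexp hζ hQrel

end compare


end Summit.RiemannHypothesis.RiemannHypothesis.Theorems.JensenPolynomials.LogBandArc

end
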